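import Literature.MathematicalPhysics.QuantumFieldTheory.Balaban1983to89.B11Eq73KernelColumnsCarrier
import Literature.MathematicalPhysics.QuantumFieldTheory.Balaban1983to89.B11Ineq73KernelLettersPerLattice
import Mathlib.Analysis.Complex.Schwarz

/-!
# `Balaban1983to89.B11Rem289KernelColumnsCarrier` — T. Bałaban, *The variational problem and background fields in renormalization group method for
lattice gauge theories*, Commun. Math. Phys. **102** (1985) 277–309 [Balaban1985Variational], the remark after Proposition 3, p. 289: **«The operator 𝔇(A′) is
an analytic function in A′, and its expansion begins with a linear term in A′, coming from the differentiation of D⁽²⁾(A′) = C⁽²⁾(A′). If we subtract these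
terms from 𝔇(A′), then we get an operator 𝔇₂(A′) for which we have the bound (73) with ε₃² instead of ε₃»** — ON THE CARRIERS OF (115), AT THE LEVEL OF
WEIGHTED KERNEL COLUMNS, WITH A LETTER-ONLY CONSTANT, file 1∕2 (tools): towards the binder `hΘ3` of `B11Eq98CurrentSlot.quadAnalytic_W80` (the kernel columns of `(HD₃)′(A′)`,
`HD₃ = HD − HC⁽²⁾`) with `θ₃ = (2ℓ + 1)Θ_H^wG/a_C` — sequel of `B11Eq73KernelColumnsCarrier` (`θ_E = 2Θ_H^wGℓ`); together the two files make the (98)-constant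
`C₄` of the W-slot a function of the letters `Θ_H^w, G, b, C₂, a_C, ε_C` only (the per-lattice suppliers `B11Ineq73KernelLettersPerLattice` ∕ `…Uniform` pay
the bond count `κ(∇)`)

statement-level skeleton of published theorems with citation tags; proofs where landed; nothing here is a claim about the Yang–Mills mass gap

PDF held: `paper:balaban1985-cmp102-variational-background` (journal page = PDF page + 276); p. 289 [PDF 13] through the verbatim quotations of
`B11Rem289KernelConcrete` (the same remark on the CONCRETE `ℤᵈ` carrier, lit-balaban p06) and `B11Ineq73KernelLettersPerLattice`.

THE ARGUMENT (not printed; the cell's reading G-adv9-52 «the stated bound holds, but not by the argument the text suggests at the radius it names», here by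
a radial Schwarz lemma at the level of COLUMN SUMS).  For `0 < ‖A′‖ < a_C` let `F(ζ) ∈ ℓ¹` be the vector of `|·|_{(−3)}`-weighted kernel entries
`((Lʲ⁽ᵇ⁾η)³/(Lʲ⁽ᵇ′⁾η)³)·k_{(HD₃)′(ζA′)}(b′, b)`, `|ζ| < a_C/‖A′‖`: (i) `F` is holomorphic (`HD₃` is analytic, so is its derivative; `PiLp 1`); (ii) `‖F(ζ)‖ ≤ (2ℓ + 1)Θ_H^wG·a_C`
uniformly — the `θ_E`-bound of the prequel for `(HD)′` plus the column letter of `H∘(C⁽²⁾)′(Z) = H∘D²C(0)(Z, ·)` (symmetry of `D²C(0)`; the one-bond column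
letter of `𝒞′` passes to `D²C(0)(Z, ·)` as the derivative of a Lipschitz-at-`0` line); (iii) `F(0) = 0` (`(HD₃)′(0) = 0`) and `F′(0) = 0` (per lattice the columns are
`O(‖·‖²)` near `0`, `B11Ineq73KernelLettersPerLattice.exists_theta3` — a qualitative input, its constant does not enter); (iv) Schwarz to second order:
`‖F(1)‖ ≤ M(‖A′‖/a_C)²`.

WHAT IS PROVED (sorry-free; no definition; nothing of the paper asserted — letters displayed as in the prequel).
* §1 `norm_le_div_mul_of_zero`, **`norm_le_mul_sq_div_of_zero_of_deriv_zero`** (Schwarz to first ∕ second order for vector-valued holomorphic maps of one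
  variable), `deriv_eq_zero_of_norm_le_sq`.
* §2 `norm_quadPart_le`, `fderiv_quadPart_zero`, **`fderiv_E3_zero`** (`(HD₃)′(0) = 0`), `analyticOnNhd_C`, `fderiv_C_zero`, `isSymmSndFDerivAt_C`,
  **`fderiv_quadPart_eq`** (`(C⁽²⁾)′(Z) = D²C(0)(Z, ·)`).
* §3 **`norm_sndFDeriv_C_single_apply_le`** (`‖(D²C(0)(Z, X·δ_b))(y)‖ ≤ g(y, b)‖Z‖‖X‖`), **`opNorm_kernel_H_fderiv_quadPart_le`**
  (`‖k_{H(C⁽²⁾)′(Z)}(b′, b)‖ ≤ ‖Z‖Σ_y hk(b′, y)g(y, b)`).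
(§4–§5 — the uniform column bound and the binder `hΘ3` itself — are the sequel `B11Rem289KernelColumnsTheta3`, split for size.)
HONEST SCOPE.  (i) Mechanism on displayed letters (`hk`, `Θ_H`, `Θ_H^w` of `H`; `g`, `G` of `𝒞′`; the Sect. C regime); suppliers of this generation:
`B9Eq3126H1kPiOneBlockColumn` (H̃_{1,k}), `B11Eq44CKernelColumnTower` (C_k).  (ii) No decay used or claimed; constants crude.  (iii) NOT summit progress (cell
pub-balaban: NE9 NOT PRINTED ∕ NOT PROVED; «NE9 ⇐ the named binders»; row WALLED ON A MODEL (O-NE9-1); spine PROVED 0∕9; rung (B)+1 on a finite T⁴ — NOT infinite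
volume, NOT mass gap, NOT BetaPertH, NOT Clay; HONEST DEPENDENCY: continuum YM on T⁴ ⇐ BetaPertH ∧ nine spine estimates (0/9 proved); BetaPertH ⇐ (D1) ∧ (D4) ∧
CAP+tail; G-an2-4 gates asym, D1 and NE2/3/4).  Filed by the NE9 crux-team leaf seat `b2b-balaban-t4-ne9-formalise-leaf-01` (gen 97); NEW file; imports
`B11Eq73KernelColumnsCarrier`, `B11Ineq73KernelLettersPerLattice`, `Mathlib.Analysis.Complex.Schwarz`; nothing modified.  Net new unproved facts: 0.
-/

noncomputable section

open scoped BigOperators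
open Finset Metric Set Filter Topology

namespace Literature.MathematicalPhysics.QuantumFieldTheory.Balaban1983to89.B11Rem289KernelColumnsCarrier

open Literature.MathematicalPhysics.QuantumFieldTheory.Balaban1983to89.B11Prop6Scheme (Prop4Hyp)
open Literature.MathematicalPhysics.QuantumFieldTheory.Balaban1983to89.B11Eq174Chart (solA Regime)
open Literature.MathematicalPhysics.QuantumFieldTheory.Balaban1983to89.B11Eq90Transpose (kernel kernel_apply single115 sum_single115 flat115_single115)
open Literature.MathematicalPhysics.QuantumFieldTheory.Balaban1983to89.B11Eq90V0primeCurrent (flat115 flat115_apply)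
open Literature.MathematicalPhysics.QuantumFieldTheory.Balaban1983to89.B11Eq90V0GroupComposed (T47 T47_apply norm_T47_le norm_T47_lt fderiv_T47
  differentiableOn_solA)
open Literature.MathematicalPhysics.QuantumFieldTheory.Balaban1983to89.B11Eq80Current (Emap E3 quadPart Emap_eq_H Emap_eq analyticOnNhd_Emap analyticOnNhd_E3
  contDiff_quadPart)
open Literature.MathematicalPhysics.QuantumFieldTheory.Balaban1983to89.B11Eq98CurrentSlot (norm_Emap_le_sq)
open Literature.MathematicalPhysics.QuantumFieldTheory.Balaban1983to89.B12SecondOrder267 (fderiv_zero_of_norm_le_sq)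
open Literature.MathematicalPhysics.QuantumFieldTheory.Balaban1983to89.B11Ineq73KernelLettersPerLattice (exists_theta3)
open Literature.MathematicalPhysics.QuantumFieldTheory.Balaban1983to89.B11Eq73KernelColumnsCarrier
open B9SectCLatticeCarrier (Bond)
open B11Eq115Space

/-! ## §1 Schwarz's lemma to second order for vector-valued holomorphic functions of one variable -/

section Schwarz

variable {F : Type*} [NormedAddCommGroup F] [NormedSpace ℂ F] [CompleteSpace F]

omit [CompleteSpace F] in
/-- **Schwarz to first order (closed form)**: `g` holomorphic on `|z| < R`, `g 0 = 0`, `‖g‖ ≤ M` there ⟹ `‖g z‖ ≤ (M/R)·|z|`.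
[cite: Balaban1985Variational, p.289 (after Prop. 3)] -/
theorem norm_le_div_mul_of_zero {g : ℂ → F} {R M : ℝ} (hg : DifferentiableOn ℂ g (ball (0 : ℂ) R))
    (h0 : g 0 = 0) (hb : ∀ z ∈ ball (0 : ℂ) R, ‖g z‖ ≤ M) {z : ℂ} (hz : z ∈ ball (0 : ℂ) R) :
    ‖g z‖ ≤ M / R * ‖z‖ := by
  -- `g` maps the ball into the closed ball of radius `M` about `g 0 = 0`
  have hmaps : MapsTo g (ball (0 : ℂ) R) (closedBall (g 0) M) := fun w hw => by
    rw [mem_closedBall, h0, dist_zero_right]; exact hb w hw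
  have key := Complex.dist_le_div_mul_dist_of_mapsTo_ball hg hmaps hz
  rwa [h0, dist_zero_right, dist_zero_right] at key

/-- **Schwarz to second order**: `g` holomorphic on `|z| < R`, `g 0 = 0`, `g′(0) = 0`, `‖g‖ ≤ M` there ⟹ `‖g z‖ ≤ M·(|z|/R)²` — the radial
device behind «(73) with ε₃² instead of ε₃» (the cell's reading of the remark after Prop. 3; cf. `B11Rem289KernelConcrete`'s T2 step).
[cite: Balaban1985Variational, p.289 (after Prop. 3)] -/
theorem norm_le_mul_sq_div_of_zero_of_deriv_zero {g : ℂ → F} {R M : ℝ} (hR : 0 < R) (hg : DifferentiableOn ℂ g (ball (0 : ℂ) R))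
    (h0 : g 0 = 0) (h1 : deriv g 0 = 0) (hb : ∀ z ∈ ball (0 : ℂ) R, ‖g z‖ ≤ M) {z : ℂ} (hz : z ∈ ball (0 : ℂ) R) :
    ‖g z‖ ≤ M * (‖z‖ / R) ^ 2 := by
  have hball : ball (0 : ℂ) R ∈ 𝓝 (0 : ℂ) := isOpen_ball.mem_nhds (mem_ball_self hR)
  -- the slope function `φ = dslope g 0`: holomorphic, `φ 0 = g′(0) = 0`, `‖φ‖ ≤ M/R`
  have hφd : DifferentiableOn ℂ (dslope g 0) (ball (0 : ℂ) R) := (Complex.differentiableOn_dslope hball).2 hg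
  have hφ0 : dslope g 0 0 = 0 := by rw [dslope_same, h1]
  have hφb : ∀ w ∈ ball (0 : ℂ) R, ‖dslope g 0 w‖ ≤ M / R := by
    intro w hw
    rcases eq_or_ne w 0 with rfl | hw0
    · rw [hφ0, norm_zero]
      exact div_nonneg ((norm_nonneg _).trans (hb 0 (mem_ball_self hR))) hR.le
    · have hgw := norm_le_div_mul_of_zero hg h0 hb hw
      rw [dslope_of_ne _ hw0, slope_def_module, h0, sub_zero, sub_zero, norm_smul, norm_inv]
      have hwpos : 0 < ‖w‖ := norm_pos_iff.2 hw0
      rw [inv_mul_le_iff₀ hwpos]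
      linarith
  -- Schwarz for `φ`
  have hφz := norm_le_div_mul_of_zero hφd hφ0 hφb hz
  have hM : 0 ≤ M := (norm_nonneg _).trans (hb 0 (mem_ball_self hR))
  rcases eq_or_ne z 0 with rfl | hz0
  · rw [h0, norm_zero]; positivity
  · have hgz : g z = z • dslope g 0 z := by
      rw [dslope_of_ne _ hz0, slope_def_module, h0, sub_zero, sub_zero, smul_smul, mul_inv_cancel₀ hz0, one_smul]
    rw [hgz, norm_smul]
    calc ‖z‖ * ‖dslope g 0 z‖ ≤ ‖z‖ * (M / R / R * ‖z‖) := mul_le_mul_of_nonneg_left hφz (norm_nonneg _)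
      _ = M * (‖z‖ / R) ^ 2 := by ring

omit [CompleteSpace F] in
/-- A derivative along which the function is `O(|t|²)` vanishes (the first-order Taylor coefficient of a function vanishing to second order).
[cite: Balaban1985Variational, p.289 (after Prop. 3)] -/
theorem deriv_eq_zero_of_norm_le_sq {g : ℂ → F} {g' : F} (hg : HasDerivAt g g' 0) (h0 : g 0 = 0) {c ρ : ℝ} (hρ : 0 < ρ)
    (hb : ∀ t : ℂ, ‖t‖ < ρ → ‖g t‖ ≤ c * ‖t‖ ^ 2) : g' = 0 := by
  have hc : 0 ≤ c := by
    by_contra hc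
    rw [not_le] at hc
    have ht : ‖((ρ / 2 : ℝ) : ℂ)‖ < ρ := by
      rw [Complex.norm_real, Real.norm_of_nonneg (by positivity)]; linarith
    have := hb _ ht
    have hpos : 0 < ‖((ρ / 2 : ℝ) : ℂ)‖ := by rw [Complex.norm_real, Real.norm_of_nonneg (by positivity)]; positivity
    nlinarith [norm_nonneg (g ((ρ / 2 : ℝ) : ℂ)), pow_pos hpos 2]
  -- `‖g′‖ ≤ C` for every `C > 0`
  have hle : ∀ C : ℝ, 0 < C → ‖g'‖ ≤ C := by
    intro C hC
    refine hg.le_of_lip' hC.le ?_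
    have hopen : {t : ℂ | ‖t‖ < min ρ (C / (c + 1))} ∈ 𝓝 (0 : ℂ) :=
      (isOpen_lt continuous_norm continuous_const).mem_nhds (by simp only [mem_setOf_eq, norm_zero]; positivity)
    filter_upwards [hopen] with t ht
    rw [h0, sub_zero, sub_zero]
    have htρ : ‖t‖ < ρ := lt_of_lt_of_le ht (min_le_left _ _)
    have htC : ‖t‖ < C / (c + 1) := lt_of_lt_of_le ht (min_le_right _ _)
    have hct : c * ‖t‖ ≤ C := by
      have h1 : c * ‖t‖ ≤ (c + 1) * ‖t‖ := by nlinarith [norm_nonneg t]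
      have h2 : (c + 1) * ‖t‖ ≤ (c + 1) * (C / (c + 1)) := mul_le_mul_of_nonneg_left htC.le (by linarith)
      rw [mul_div_cancel₀ _ (by linarith : c + 1 ≠ 0)] at h2
      linarith
    calc ‖g t‖ ≤ c * ‖t‖ ^ 2 := hb t htρ
      _ = (c * ‖t‖) * ‖t‖ := by ring
      _ ≤ C * ‖t‖ := mul_le_mul_of_nonneg_right hct (norm_nonneg _)
  exact norm_le_zero_iff.1 (le_of_forall_pos_le_add fun C hC => by simpa using hle C hC)

end Schwarz

variable {𝔸 : Type*} [NormedRing 𝔸] [NormedAlgebra ℂ 𝔸] [FiniteDimensional ℂ 𝔸] [CompleteSpace 𝔸]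
variable {d : ℕ} {Pd : Fin d → ℕ} {L η : ℝ} [Fact (0 < L)] [Fact (0 < η)] {lev₀ : Bond d Pd → ℕ} {κ' : Type*} [Fintype κ']
  {lev₁ : κ' → ℕ} {Dc : (Bond d Pd → 𝔸) →ₗ[ℂ] (κ' → 𝔸)}
variable {β : Type*} [Fintype β] [DecidableEq β] {wB : β → ℝ} [Fact (∀ y, 0 < wB y)]
variable {H : NegSup wB 𝔸 →L[ℂ] Space115 L η lev₀ lev₁ Dc} {C : Space115 L η lev₀ lev₁ Dc → NegSup wB 𝔸} {b C₂ c₄ aC εC : ℝ}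

/-! ## §2 `(HD₃)′(0) = 0` and the analytic structure of `C` at `0` -/

section Structure

omit [FiniteDimensional ℂ 𝔸] [CompleteSpace 𝔸] [DecidableEq β] in
/-- The quadratic part `C⁽²⁾(Y) = ½D²C(0)(Y, Y)` is `O(‖Y‖²)`: `‖C⁽²⁾(Y)‖ ≤ ½‖D²C(0)‖·‖Y‖²`. [cite: Balaban1985Variational, (56) p.286] -/
theorem norm_quadPart_le (Y : Space115 L η lev₀ lev₁ Dc) :
    ‖quadPart C Y‖ ≤ 2⁻¹ * ‖iteratedFDeriv ℂ 2 C 0‖ * ‖Y‖ ^ 2 := by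
  unfold quadPart
  rw [norm_smul, norm_inv, RCLike.norm_ofNat]
  have h := (iteratedFDeriv ℂ 2 C 0).le_opNorm (fun _ => Y)
  rw [Fin.prod_univ_two] at h
  calc 2⁻¹ * ‖iteratedFDeriv ℂ 2 C 0 fun _ => Y‖ ≤ 2⁻¹ * (‖iteratedFDeriv ℂ 2 C 0‖ * (‖Y‖ * ‖Y‖)) := by gcongr
    _ = _ := by ring

omit [FiniteDimensional ℂ 𝔸] [CompleteSpace 𝔸] [DecidableEq β] in
/-- `(C⁽²⁾)′(0) = 0`. [cite: Balaban1985Variational, (56) p.286] -/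
theorem fderiv_quadPart_zero : fderiv ℂ (quadPart C) (0 : Space115 L η lev₀ lev₁ Dc) = 0 :=
  fderiv_zero_of_norm_le_sq (𝕜 := ℂ) one_pos fun Y _ => norm_quadPart_le Y

omit [CompleteSpace 𝔸] [DecidableEq β] in
/-- **`(HD₃)′(0) = 0`**: the derivative of `HD₃ = HD − HC⁽²⁾` vanishes at the origin (both terms are `O(‖A′‖²)`; «𝔇₂(A′) … (73) with ε₃² instead of ε₃»
starts one order higher than 𝔇). [cite: Balaban1985Variational, p.289 (after Prop. 3), (55)–(56) p.286] -/
theorem fderiv_E3_zero (RC : Regime H 0 C b 0 C₂ c₄ 0 aC εC) (hC : Prop4Hyp C C₂ c₄) (haC : 0 < aC) :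
    fderiv ℂ (E3 H C εC) (0 : Space115 L η lev₀ lev₁ Dc) = 0 := by
  have hE : E3 H C εC = fun Y : Space115 L η lev₀ lev₁ Dc => Emap H C εC Y - H (quadPart C Y) := rfl
  have h1 : fderiv ℂ (Emap H C εC) (0 : Space115 L η lev₀ lev₁ Dc) = 0 :=
    fderiv_zero_of_norm_le_sq (𝕜 := ℂ) haC fun Y hY => norm_Emap_le_sq RC hY
  have hEd : DifferentiableAt ℂ (Emap H C εC) (0 : Space115 L η lev₀ lev₁ Dc) :=
    (analyticOnNhd_Emap RC hC 0 (mem_ball_self haC)).differentiableAt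
  have hqd : DifferentiableAt ℂ (quadPart C) (0 : Space115 L η lev₀ lev₁ Dc) :=
    ((contDiff_quadPart C (n := 1)).differentiable one_ne_zero).differentiableAt
  have h2 : fderiv ℂ (fun Y => H (quadPart C Y)) (0 : Space115 L η lev₀ lev₁ Dc) = H.comp (fderiv ℂ (quadPart C) 0) :=
    (H.hasFDerivAt.comp (0 : Space115 L η lev₀ lev₁ Dc) hqd.hasFDerivAt).fderiv
  have hHq : DifferentiableAt ℂ (fun Y => H (quadPart C Y)) (0 : Space115 L η lev₀ lev₁ Dc) := H.differentiableAt.comp _ hqd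
  rw [hE, fderiv_fun_sub hEd hHq, h1, h2, fderiv_quadPart_zero, ContinuousLinearMap.comp_zero, sub_zero]

omit [DecidableEq β] in
/-- `C` is analytic at every point of its ball (finite-dimensional carrier: `Prop4Hyp`'s `DifferentiableOn` ⟹ analytic, Osgood).
[cite: Balaban1985Variational, (44) p.285, p.286] -/
theorem analyticOnNhd_C (hC : Prop4Hyp C C₂ c₄) : AnalyticOnNhd ℂ C (ball (0 : Space115 L η lev₀ lev₁ Dc) c₄) := by
  have h := Literature.Analysis.Complex.SCV.analyticOnNhd_of_differentiableOn hC.differentiableOn (isOpen_lt continuous_norm continuous_const)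
  refine h.mono fun Y hY => ?_
  simpa using hY

omit [FiniteDimensional ℂ 𝔸] [CompleteSpace 𝔸] [DecidableEq β] in
/-- `𝒞′(0) = 0` (`C` is `O(‖Y‖²)`, (44)/(46)). [cite: Balaban1985Variational, (44) p.285, (46) p.285] -/
theorem fderiv_C_zero (RC : Regime H 0 C b 0 C₂ c₄ 0 aC εC) (haC : 0 < aC) : fderiv ℂ C (0 : Space115 L η lev₀ lev₁ Dc) = 0 := by
  have hc₄ : 0 < c₄ := by linarith [RC.dom, RC.ε₄_nonneg]
  exact fderiv_zero_of_norm_le_sq (𝕜 := ℂ) hc₄ fun Y hY => RC.quad.quad Y hY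

omit [DecidableEq β] in
/-- The second derivative of `C` at `0` is symmetric (analytic ⟹ `C^∞`). [cite: Balaban1985Variational, (56) p.286] -/
theorem isSymmSndFDerivAt_C (RC : Regime H 0 C b 0 C₂ c₄ 0 aC εC) (hC : Prop4Hyp C C₂ c₄) (haC : 0 < aC) :
    IsSymmSndFDerivAt ℂ C (0 : Space115 L η lev₀ lev₁ Dc) := by
  have hc₄ : 0 < c₄ := by linarith [RC.dom, RC.ε₄_nonneg]
  exact (((analyticOnNhd_C hC) 0 (mem_ball_self hc₄)).contDiffAt (n := ⊤)).isSymmSndFDerivAt le_top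

omit [DecidableEq β] in
/-- **`(C⁽²⁾)′(Z) = D²C(0)(Z, ·)`**: the derivative of the quadratic part at `Z` is the second derivative of `C` at `0` with one slot filled by `Z` (symmetry of
`D²C(0)`). [cite: Balaban1985Variational, (56) p.286, (78) p.290] -/
theorem fderiv_quadPart_eq (RC : Regime H 0 C b 0 C₂ c₄ 0 aC εC) (hC : Prop4Hyp C C₂ c₄) (haC : 0 < aC) (Z : Space115 L η lev₀ lev₁ Dc) :
    fderiv ℂ (quadPart C) Z = fderiv ℂ (fderiv ℂ C) 0 Z := by
  set B₂ := iteratedFDeriv ℂ 2 C (0 : Space115 L η lev₀ lev₁ Dc) with hB₂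
  set diag : Space115 L η lev₀ lev₁ Dc →L[ℂ] (Fin 2 → Space115 L η lev₀ lev₁ Dc) := ContinuousLinearMap.pi fun _ => ContinuousLinearMap.id ℂ _
    with hdiag
  have hq : quadPart C = (2 : ℂ)⁻¹ • fun Y => B₂ (diag Y) := by
    funext Y; rfl
  have hd : HasFDerivAt (fun Y : Space115 L η lev₀ lev₁ Dc => B₂ (diag Y)) ((B₂.linearDeriv (diag Z)).comp diag) Z :=
    (B₂.hasFDerivAt (diag Z)).comp Z diag.hasFDerivAt
  rw [hq, (hd.const_smul (2 : ℂ)⁻¹).fderiv]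
  ext h
  have hsymm := isSymmSndFDerivAt_C RC hC haC
  simp only [FunLike.coe_smul, Pi.smul_apply, ContinuousLinearMap.comp_apply, ContinuousMultilinearMap.linearDeriv_apply, Fin.sum_univ_two,
    hB₂, iteratedFDeriv_two_apply]
  have e0 : ∀ i, Function.update (diag Z) 0 (diag h 0) i = ![h, Z] i := by
    intro i; fin_cases i <;> rfl
  have e1 : ∀ i, Function.update (diag Z) 1 (diag h 1) i = ![Z, h] i := by
    intro i; fin_cases i <;> rfl
  simp only [e0, e1, Matrix.cons_val_zero, Matrix.cons_val_one]
  rw [hsymm h Z, ← two_smul ℂ, smul_smul, inv_mul_cancel₀ two_ne_zero, one_smul]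

end Structure

/-! ## §3 The one-bond column letter of `D²C(0)(Z, ·)` and of `H∘(C⁽²⁾)′(Z)` -/

section QuadLetter

variable (RC : Regime H 0 C b 0 C₂ c₄ 0 aC εC) (hC : Prop4Hyp C C₂ c₄) (haC : 0 < aC)
  {hk : Bond d Pd → β → ℝ} (hk0 : ∀ b' y, 0 ≤ hk b' y)
  (hHk : ∀ (y : β) (Z : 𝔸) (b' : Bond d Pd), ‖flat115 (H ((NegSup.equiv wB 𝔸).symm (Pi.single y Z))) b'‖ ≤ hk b' y * ‖Z‖)
  {gC : β → Bond d Pd → ℝ} (hgC0 : ∀ y bb, 0 ≤ gC y bb)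
  (hCg : ∀ A : Space115 L η lev₀ lev₁ Dc, ‖A‖ < εC + aC → ∀ (bb : Bond d Pd) (X : 𝔸) (y : β),
      ‖NegSup.equiv wB 𝔸 (fderiv ℂ C A (single115 (lev₁ := lev₁) (Dc := Dc) bb X)) y‖ ≤ gC y bb * ‖A‖ * ‖X‖)

omit [DecidableEq β] in
include RC hC haC hgC0 hCg in
/-- **THE ONE-BOND COLUMN LETTER PASSES TO `D²C(0)(Z, ·)`**: `‖(D²C(0)(Z, X·δ_b))(y)‖ ≤ g(y, b)·‖Z‖·‖X‖` — the derivative at `t = 0` of the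
`g(y, b)‖Z‖‖X‖`-Lipschitz-at-`0` line `t ↦ (𝒞′(tZ)(X·δ_b))(y)` (`𝒞′(0) = 0`). [cite: Balaban1985Variational, (56) p.286, (73) p.289] -/
theorem norm_sndFDeriv_C_single_apply_le (Z : Space115 L η lev₀ lev₁ Dc) (bb : Bond d Pd) (X : 𝔸) (y : β) :
    ‖NegSup.equiv wB 𝔸 (fderiv ℂ (fderiv ℂ C) 0 Z (single115 (lev₁ := lev₁) (Dc := Dc) bb X)) y‖ ≤ gC y bb * ‖Z‖ * ‖X‖ := by
  have hc₄ : 0 < c₄ := by linarith [RC.dom, RC.ε₄_nonneg]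
  have hC0d : DifferentiableAt ℂ (fderiv ℂ C) (0 : Space115 L η lev₀ lev₁ Dc) :=
    ((analyticOnNhd_C hC).fderiv 0 (mem_ball_self hc₄)).differentiableAt
  have h : HasLineDerivAt ℂ (fderiv ℂ C) (fderiv ℂ (fderiv ℂ C) 0 Z) 0 Z := hC0d.hasFDerivAt.hasLineDerivAt Z
  set ev : (Space115 L η lev₀ lev₁ Dc →L[ℂ] NegSup wB 𝔸) →L[ℂ] 𝔸 :=
    (NegSup.evalCLM ℂ wB y).comp (ContinuousLinearMap.apply ℂ (NegSup wB 𝔸) (single115 (lev₁ := lev₁) (Dc := Dc) bb X)) with hev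
  have h2 : HasLineDerivAt ℂ (fun T => ev (fderiv ℂ C T)) (ev (fderiv ℂ (fderiv ℂ C) 0 Z)) 0 Z := by
    unfold HasLineDerivAt at h ⊢
    exact ev.hasFDerivAt.comp_hasDerivAt (0 : ℂ) h
  have hline : HasDerivAt (fun t : ℂ => NegSup.equiv wB 𝔸 (fderiv ℂ C ((0 : Space115 L η lev₀ lev₁ Dc) + t • Z) (single115 (lev₁ := lev₁) (Dc := Dc) bb X)) y)
      (NegSup.equiv wB 𝔸 (fderiv ℂ (fderiv ℂ C) 0 Z (single115 (lev₁ := lev₁) (Dc := Dc) bb X)) y) 0 := by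
    unfold HasLineDerivAt at h2
    simpa [hev] using h2
  have hK : 0 ≤ gC y bb * ‖Z‖ * ‖X‖ := by have := hgC0 y bb; positivity
  refine hline.le_of_lip' hK ?_
  have hopen : {t : ℂ | ‖t‖ * ‖Z‖ < εC + aC} ∈ 𝓝 (0 : ℂ) :=
    (isOpen_lt (continuous_norm.mul continuous_const) continuous_const).mem_nhds
      (by simp only [mem_setOf_eq, Pi.mul_apply, norm_zero, zero_mul]; linarith [RC.ε₄_nonneg])
  filter_upwards [hopen] with t ht
  have htZ' : ‖t • Z‖ < εC + aC := by simpa [Pi.mul_apply, norm_smul] using ht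
  rw [zero_smul, add_zero, fderiv_C_zero RC haC, zero_add]
  simp only [zero_apply, NegSup.equiv_zero, Pi.zero_apply, sub_zero]
  calc _ ≤ gC y bb * ‖t • Z‖ * ‖X‖ := hCg _ htZ' bb X y
    _ = gC y bb * ‖Z‖ * ‖X‖ * ‖t‖ := by rw [norm_smul]; ring

include RC hC haC hk0 hHk hgC0 hCg in
/-- **THE ENTRYWISE MAJORANT OF THE KERNEL OF `H∘(C⁽²⁾)′(Z)`**: `‖k_{H(C⁽²⁾)′(Z)}(b′, b)‖ ≤ ‖Z‖·Σ_y hk(b′, y)g(y, b)` — the one-block letter of `H` and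
§3's letter of `D²C(0)(Z, ·) = (C⁽²⁾)′(Z)`. [cite: Balaban1985Variational, (78) p.290, (85)–(86) p.291] -/
theorem opNorm_kernel_H_fderiv_quadPart_le (Z : Space115 L η lev₀ lev₁ Dc) (b' bb : Bond d Pd) :
    ‖kernel (H.comp (fderiv ℂ (quadPart C) Z)) b' bb‖ ≤ ‖Z‖ * ∑ y, hk b' y * gC y bb := by
  have hrhs : 0 ≤ ‖Z‖ * ∑ y, hk b' y * gC y bb := mul_nonneg (norm_nonneg _) (Finset.sum_nonneg fun y _ => mul_nonneg (hk0 _ _) (hgC0 _ _))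
  refine ContinuousLinearMap.opNorm_le_bound _ hrhs fun X => ?_
  rw [kernel_apply, ContinuousLinearMap.comp_apply, flat_apply_eq_sum_single, fderiv_quadPart_eq RC hC haC]
  calc ‖∑ y, flat115 (H ((NegSup.equiv wB 𝔸).symm (Pi.single y (NegSup.equiv wB 𝔸
          (fderiv ℂ (fderiv ℂ C) 0 Z (single115 (lev₁ := lev₁) (Dc := Dc) bb X)) y)))) b'‖
      ≤ ∑ y, hk b' y * ‖NegSup.equiv wB 𝔸 (fderiv ℂ (fderiv ℂ C) 0 Z (single115 (lev₁ := lev₁) (Dc := Dc) bb X)) y‖ :=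
        (norm_sum_le _ _).trans (Finset.sum_le_sum fun y _ => hHk y _ b')
    _ ≤ ∑ y, hk b' y * (gC y bb * ‖Z‖ * ‖X‖) :=
        Finset.sum_le_sum fun y _ => mul_le_mul_of_nonneg_left (norm_sndFDeriv_C_single_apply_le RC hC haC hgC0 hCg Z bb X y) (hk0 _ _)
    _ = ‖Z‖ * (∑ y, hk b' y * gC y bb) * ‖X‖ := by rw [Finset.mul_sum, Finset.sum_mul]; exact Finset.sum_congr rfl fun y _ => by ring

end QuadLetter

end Literature.MathematicalPhysics.QuantumFieldTheory.Balaban1983to89.B11Rem289KernelColumnsCarrier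

end
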